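import Summits.ABC.IUTFork.Cor312SlotLicenceContentCriterion
import Summits.ABC.IUTFork.Cor312LicenceExactContentMGenuine
import Summits.ABC.IUTFork.Cor312ThetaSlotM
import HarnessLib

/-!
# [IUTchIII] Cor. 3.12, Step (xi-f) IN READING (P): the SLOT LICENCE at the M-LEVEL sharp setting of record `settingPrVolSharpM`, decided
# EXACTLY per summand by ONE content integer — that of the LAST-slot box alone — and the radii of the unit-log lattices (all strata)

PROOF-ONLY file (D-0012; no definitions, no `Prop` facts, no instances) of the abc-iut cell (branch C certificate seat abc-iut-C-cert-2 gen 4;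
row «P:M-SLOT-LICENCE-EXACT», part 2 of 2 over `Cor312SlotLicenceContentCriterion`). The reading-(P) twin of abc-iut-w5-d166's
`Cor312LicenceExactContentM` (the (U) licence / S_H, decided) and `Cor312LicenceExactContentMGenuine` (own-ideles form). TAKES NO SIDE on
[IUTchIII] Cor. 3.12 (kurims manuscript p. 173–174; Step (x) p. 181, Step (xi-f) p. 184) or on the reading (U)/(P).

OBJECT: `Cor312.Setting.SlotLicence` (abc-iut-C-cert-2 `Cor312SlotHull`, p458847: at every label `j = i+1 ∈ 𝔽_l^⋇` and every `v_ℚ` the q-pilot region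
lies in the (Ind1)-FREE slot hull) — the S-side clause of the γ / joint certificates; its NEGATION is the antecedent of the M-line binders
`hNumPOffBad_M` / `hNumPOffC_M` (abc-iut-C-cert-1 p469493) and, with `¬S_H ∨ mixing`, of `hNumJoint_M` / `hNumJointC_M` (p469550 / p469640) — at
abc-iut-s2-p8's summand-route M-LEVEL sharp setting `Thm311.Real.settingPrVolSharpM D hlog t tq …` (carriers `K_{v̲}`, `v̲ ∈ V̲`, [IUTchI] Def. 3.1 (e);
sharp Θ-boxes `ι_j(t_{Θ,j,v̲_j})·(R_I)^∼`, q-centre `λ_q`; idele BINDERS `t`, `tq`). PROVED (all strata — tame, boundary, wild, `p = 2`; `p = p_u`):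
* §1 the dischargers of part 1's `hsub` (the region — product of the LAST-slot boxes, abc-iut-s2-p9 `thetaRegion3_settingPrVolSharpM_eq_preimage_pi` — inside
  `e⁻¹(Π_{v⃗} p^{m(v⃗)}·log_p(R_{v⃗}^×))` for ANY `m` bracketing the last-slot boxes; (Ind2)-families map it onto itself, NO capsule symmetry) and `hwit`
  (exact-content witnesses IN the region, any label, any Θ-ideles), and **`qRegion_subset_thetaSlotHull_settingPrVolSharpM_iff_of_content`**: for the EXACT
  content family `m` of the LAST-slot boxes and norm-dominating `cout(v̲) ∈ log_p(𝒪^×_{K_{v̲}})`, «`qRegion (j,u) ⊆ slot hull (j,u)` ⟺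
  `∀ v⃗, p^{m(v⃗)}·‖t_{q,v̲_j}‖ ≤ ∏_a ‖cout(v̲_a)‖`»; archimedean packets automatic;
* §2 CONTENT-FREE forms: **`…_iff`** («⟺ `∀ v⃗ ∀ m ∈ ℤ`, last-slot box `⊆ p^m·log_p(R_{v⃗}^×)` `→ p^m·‖t_{q,v̲_j}‖ ≤ ∏_a ‖cout(v̲_a)‖`») and, with
  abc-iut-c312-5's exact content cell `iota_smul_normalizedPacket_subset_zpow_smul_logPacket_iff`, **`…_iff_radii`**: «⟺ `∀ v⃗ ∀ m`,
  (`∀ J, p^m·‖t_{Θ,j,v̲_j}‖ ≤ p^{−(d_I − d_{L_J})}·∏_b ρ_in(v̲_b)`) `→ p^m·‖t_{q,v̲_j}‖ ≤ ∏_b ρ_out(v̲_b)`» — the LAST slot `a = j` ONLY, where the (U) form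
  (abc-iut-w5-d166 `qRegion_subset_thetaHull_settingPrVolSharpM_iff_radii`) quantifies over ALL slots `a` (so, as sets of conditions, (P) ⟹ (U):
  abc-iut-C-cert-2 `licence_of_slotLicence`);
* §3 **`slotLicence_settingPrVolSharpM_iff_radii`** (`SlotLicence` ⟺ §2 at every `(i+1, u)`) and the OWN-IDELES form
  **`slotLicence_settingPrVolSharpM_tOfIdeleData_iff_radii`** (`‖t_{Θ,i+1,v̲}‖ = ‖t_{q,v̲}‖^{(i+1)²}`, abc-iut-w5-d166 `norm_tThetaM_eq_norm_tqM_pow`): the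
  antecedent «OUR M-level slot licence FAILS at `T`» of the M γ / joint binders is an EXPLICIT per-place integer condition on the q-idele norms and the
  radii (`ρ_in`, `ρ_out`, differents) of the genuine `K_{v̲}` — the SAME per-place columns the R-W WINDOW-TABLE tabulates.

HONEST SCOPE: the slot licence is a STRONGER-THAN-PRINT set-level reading of Step (xi-f) (print: hull of the union of ALL possible images, p. 184 l. 26–29;
ADJUDICATION-SPEC §2 (G1′)); OUR sharp containers, OUR typed (Ind2)/(Ind3); nothing here bears on the printed GLOBAL inequality or on the NUMBER-level per-image
Corollary `T.Cor312PerImageOf`; refuted/inhabited-as-typed ≠ in print. [cite: Mochizuki2012, IUTchIII Cor. 3.12 p. 173–174, Step (x) p. 181, Step (xi)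
p. 183–184; Thm. 3.11 (i) (Ind2) p. 154; Rmk. 3.9.5 (i)(ii) p. 127; IUTchIV Prop. 1.1 p. 9, Prop. 1.2 (i)(ii) p. 10; IUTchI Def. 3.1 (e) p. 62]
[cite: DupuyHilado2025, §3.4, §3.7, §3.9, §4.9, §4.11–4.12] [cite: WeilBNT1967, Ch. II §2, Th. 1–2] [claim: Mochizuki2012, status: disputed] for every IUT
sentence quoted. typed ≠ proved (these: proved); instantiated ≠ endorsed.
-/

noncomputable section

open Set Function NumberField IsDedekindDomain
open scoped Pointwise

namespace Summit.ABC.IUTFork.Thm311.Real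

open Cor312 Cor312Vol Literature.IUT.LogThetaLattice Literature.IUT.LogVolume Literature.IUT.HodgeTheaters
  Literature.NumberTheory.NumberFields Literature.NumberTheory.GaloisRepresentations.Ultrametric

variable {F K Fbar : Type} [Field F] [NumberField F] [Field K] [NumberField K] [Algebra F K]
  [Field Fbar] [Algebra F Fbar] [Algebra K Fbar] {E : WeierstrassCurve F} [E.IsElliptic] {l : ℕ}
  {Pb : BadPlacePredicates K} (D : InitialThetaData F K Fbar E l Pb) {logvK : PadicLogsVal K}
  (hlog : LogvAnalyticVal logvK)
  (t : ∀ (u : FinitePlace ℚ) (_ : Fin (thetaIndexOfInitial D).lstar) (x : (thetaIndexOfInitial D).Fibre (Val.non u)),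
    kOfM D (ratChar u) u (natCast_ratChar_mem u) x)
  (tq : ∀ (u : FinitePlace ℚ) (x : (thetaIndexOfInitial D).Fibre (Val.non u)),
    kOfM D (ratChar u) u (natCast_ratChar_mem u) x)
  (M : Type) [Field M] [NumberField M]
  (archPk : ∀ (j : (thetaIndexOfInitial D).Label) (vQ : (thetaIndexOfInitial D).VQ),
    Set ((logShellsOfInitialDH D logvK).Packet j vQ))
  (archSub : ∀ (j : (thetaIndexOfInitial D).Label) (v : (thetaIndexOfInitial D).V),
    Set ((logShellsOfInitialDH D logvK).Packet j ((thetaIndexOfInitial D).over v)))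
  (Ψ : ℤ → ∀ v : (thetaIndexOfInitial D).V, v ∈ (thetaIndexOfInitial D).Vbad →
    Set ((logShellsOfInitialDH D logvK).StarPacket v))
  (act : ℤ → ∀ v : (thetaIndexOfInitial D).V, v ∈ (thetaIndexOfInitial D).Vbad →
    (logShellsOfInitialDH D logvK).StarPacket v → Module.End ℚ ((logShellsOfInitialDH D logvK).StarPacket v))
  (Mmod : ℤ → ∀ j : (thetaIndexOfInitial D).LabelStar, Set ((logShellsOfInitialDH D logvK).GlobalPacket j.1))
  (region : ℤ → ∀ j : (thetaIndexOfInitial D).LabelStar, FinDivisor M → ∀ vQ : (thetaIndexOfInitial D).VQ,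
    Set ((logShellsOfInitialDH D logvK).Packet j.1 vQ))
  (n : ℤ) {HT : Type} {LogLink : HT → HT → Type} {IsFull : ∀ {s t : HT}, LogLink s t → Prop}
  (lat : LGPGaussianLogThetaLattice LogLink IsFull)
  {Frd : Type} {IsoF : Frd → Frd → Type} {Ob : Frd → Type} {realify : Frd → Frd} {Strip : Type}
  {IsoS : Strip → Strip → Type}
  {Mv : ∀ v : (thetaIndexOfInitial D).V, v ∈ (thetaIndexOfInitial D).Vbad → Type} [∀ v h, Monoid (Mv v h)]
  (sig : GlobalLGPFrobenioidSignature (thetaIndexOfInitial D).lstar (thetaIndexOfInitial D).V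
    (· ∈ (thetaIndexOfInitial D).Vbad) Frd IsoF Ob realify Strip IsoS Mv)
  (split : SplittingMonoids Mv) {ObΔ : Type}
  {N : ∀ v : (thetaIndexOfInitial D).V, v ∈ (thetaIndexOfInitial D).Vbad → Type} [∀ v h, Monoid (N v h)]
  (qData : QPilotData ObΔ N)
  (htq0 : ∀ u x, tq u x ≠ 0) (Sq : Finset (FinitePlace ℚ))
  (htq1 : ∀ (u : FinitePlace ℚ) (x : (thetaIndexOfInitial D).Fibre (Val.non u)), u ∉ Sq → ‖tq u x‖ = 1)

/-! ## §1. The dischargers and the per-packet SLOT criterion with a content family -/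

/-- **`hsub` for the SLOT images at the M-level setting, ANY label**: if every LAST-slot box `ι_j(t_{Θ,j,v̲_j})·(R_I)^∼` at `(j, u)` lies in
`p^{m(v⃗)}·log_p(R_{v⃗}^×)` (`hm0`; NO capsule symmetry, NO condition on the other slots), then so does, summand-wise, the union of the SLOT images: the
(Ind3)-region is the product of the last-slot boxes (abc-iut-s2-p9 `thetaRegion3_settingPrVolSharpM_eq_preimage_pi`) and every (Ind2)-family maps
`e⁻¹(Π_{v⃗} p^{m(v⃗)}·log_p(R_{v⃗}^×))` onto itself (abc-iut-s2-p7 `sUnion_thetaSlotImages_subset_preimage_pi_zpow_smul_logPacket`).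
[cite: DupuyHilado2025, §3.9, §4.9, §4.11] [cite: Mochizuki2012, IUTchIII Thm. 3.11 (i) (Ind2) p. 154] -/
theorem sUnion_thetaSlotImages_settingPrVolSharpM_subset (j : (thetaIndexOfInitial D).Label) (u : FinitePlace ℚ)
    (m : ((thetaIndexOfInitial D).Caps j → (thetaIndexOfInitial D).Fibre (Val.non u)) → ℤ)
    (hm0 : ∀ e : (thetaIndexOfInitial D).Caps j → (thetaIndexOfInitial D).Fibre (Val.non u),
      iota (ratChar u) ((presAtM D hlog u).kk e) (Fin.last _) ((presAtM D hlog u).labelIdele (t u) j (e (Fin.last _))) •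
          (normalizedPacket (ratChar u) ((presAtM D hlog u).kk e) : Set ((presAtM D hlog u).X e)) ⊆
        (((ratChar u : ℕ) : ℚ_[ratChar u]) ^ m e) • (logPacket (ratChar u) ((presAtM D hlog u).kk e) : Set ((presAtM D hlog u).X e))) :
    ⋃₀ (settingPrVolSharpM D hlog t tq M archPk archSub Ψ act Mmod region n lat sig split qData htq0 Sq htq1).thetaSlotImages j
        (Val.non u) ⊆
      (presAtM D hlog u).comparison j ⁻¹' Set.pi univ fun e =>
        (((ratChar u : ℕ) : ℚ_[ratChar u]) ^ m e) • (logPacket (ratChar u) ((presAtM D hlog u).kk e) : Set ((presAtM D hlog u).X e)) := by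
  refine sUnion_thetaSlotImages_subset_preimage_pi_zpow_smul_logPacket (P := (settingPrVolSharpM D hlog t tq M archPk archSub Ψ act Mmod region n lat sig split qData htq0 Sq htq1)) (presAtM D hlog u) j m ?_
  rw [thetaRegion3_settingPrVolSharpM_eq_preimage_pi D hlog tq M archPk archSub Ψ act Mmod region n lat sig split qData htq0 Sq htq1 t j u]
  refine Set.preimage_mono (Set.pi_mono fun e _ => ?_)
  rw [PadicPresentation.sharpBox]
  exact hm0 e

/-- **`hwit` for the SLOT criterion at the M-level setting, any label, any Θ-ideles**: if `m(v⃗)` is the EXACT content of the LAST-slot box at `v⃗`, the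
(Ind3)-region carries at `v⃗` a vector of content exactly `p^{m(v⃗)}` (put the witness at `v⃗` and `0` elsewhere; abc-iut-s2-p7
`exists_mem_thetaRegion3_comparison_eq`). [cite: DupuyHilado2025, §3.7, §3.9] -/
theorem exists_mem_thetaRegion3_settingPrVolSharpM_exact_content (j : (thetaIndexOfInitial D).Label) (u : FinitePlace ℚ)
    (m : ((thetaIndexOfInitial D).Caps j → (thetaIndexOfInitial D).Fibre (Val.non u)) → ℤ)
    (e : (thetaIndexOfInitial D).Caps j → (thetaIndexOfInitial D).Fibre (Val.non u))
    (hm0 : iota (ratChar u) ((presAtM D hlog u).kk e) (Fin.last _) ((presAtM D hlog u).labelIdele (t u) j (e (Fin.last _))) •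
        (normalizedPacket (ratChar u) ((presAtM D hlog u).kk e) : Set ((presAtM D hlog u).X e)) ⊆
      (((ratChar u : ℕ) : ℚ_[ratChar u]) ^ m e) • (logPacket (ratChar u) ((presAtM D hlog u).kk e) : Set ((presAtM D hlog u).X e)))
    (hm1 : ¬ iota (ratChar u) ((presAtM D hlog u).kk e) (Fin.last _) ((presAtM D hlog u).labelIdele (t u) j (e (Fin.last _))) •
        (normalizedPacket (ratChar u) ((presAtM D hlog u).kk e) : Set ((presAtM D hlog u).X e)) ⊆
      (((ratChar u : ℕ) : ℚ_[ratChar u]) ^ (m e + 1)) • (logPacket (ratChar u) ((presAtM D hlog u).kk e) : Set ((presAtM D hlog u).X e))) :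
    ∃ x ∈ (settingPrVolSharpM D hlog t tq M archPk archSub Ψ act Mmod region n lat sig split qData htq0 Sq htq1).thetaRegion3 j (Val.non u),
      (presAtM D hlog u).comparison j x e ∈
          (((ratChar u : ℕ) : ℚ_[ratChar u]) ^ m e) • (logPacket (ratChar u) ((presAtM D hlog u).kk e) : Set ((presAtM D hlog u).X e)) ∧
        (presAtM D hlog u).comparison j x e ∉
          (((ratChar u : ℕ) : ℚ_[ratChar u]) ^ (m e + 1)) • (logPacket (ratChar u) ((presAtM D hlog u).kk e) : Set ((presAtM D hlog u).X e)) := by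
  classical
  obtain ⟨y, hyB, hy1⟩ := Set.not_subset.mp hm1
  have hy0 := hm0 hyB
  have hbox : (presAtM D hlog u).sharpBox (t u) j e =
      iota (ratChar u) ((presAtM D hlog u).kk e) (Fin.last _) ((presAtM D hlog u).labelIdele (t u) j (e (Fin.last _))) •
        (normalizedPacket (ratChar u) ((presAtM D hlog u).kk e) : Set ((presAtM D hlog u).X e)) := by
    rw [PadicPresentation.sharpBox]
  have hB0 : ∀ e', (0 : (presAtM D hlog u).X e') ∈ (presAtM D hlog u).sharpBox (t u) j e' :=
    fun e' => Set.mem_smul_set.mpr ⟨0, Subring.zero_mem _, smul_zero _⟩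
  obtain ⟨x, hxR, hx⟩ := exists_mem_thetaRegion3_comparison_eq (P := (settingPrVolSharpM D hlog t tq M archPk archSub Ψ act Mmod region n lat sig split qData htq0 Sq htq1)) (presAtM D hlog u) j
    ((presAtM D hlog u).sharpBox (t u) j)
    (subset_of_eq (thetaRegion3_settingPrVolSharpM_eq_preimage_pi D hlog tq M archPk archSub Ψ act Mmod region n lat sig split qData htq0 Sq
      htq1 t j u).symm)
    hB0 e (z := y) (by rw [hbox]; exact hyB)
  refine ⟨x, hxR, ?_⟩
  have hxy : (presAtM D hlog u).comparison j x e = y := hx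
  rw [hxy]
  exact ⟨hy0, hy1⟩

/-- **THE PER-PACKET SLOT CRITERION AT THE M LEVEL (content form)**: for the EXACT content family `m` of the LAST-slot boxes `ι_j(t_{Θ,j,v̲_j})·(R_I)^∼` and
elements `cout(v̲)` of LARGEST norm in the `log_p(𝒪^×_{K_{v̲}})`: `qRegion (j,u) ⊆ slot hull (j,u) ⟺ ∀ v⃗, p_u^{m(v⃗)}·‖t_{q,v̲_j}‖ ≤ ∏_a ‖cout(v̲_a)‖`
(part 1 at abc-iut-w5-d166's presentation `presAtM`: `hframe` abc-iut-s2-p8, `hq` definitional, `hism` abc-iut-s2-p9's fullness of Ism landing in the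
(Ind2)-families (abc-iut-s2-p7 `exists_ind2Family_comparison_eq_congr`), `hsub`/`hwit` above; `‖c_{q,(v⃗,J)}‖ = ‖t_{q,v̲_j}‖`).
[cite: Mochizuki2012, IUTchIII Cor. 3.12 Step (x) p. 181, Step (xi-f) p. 184; Thm. 3.11 (i) (Ind2) p. 154] [cite: DupuyHilado2025, §3.9, §4.9, §4.12] -/
theorem qRegion_subset_thetaSlotHull_settingPrVolSharpM_iff_of_content (j : (thetaIndexOfInitial D).Label) (u : FinitePlace ℚ)
    (m : ((thetaIndexOfInitial D).Caps j → (thetaIndexOfInitial D).Fibre (Val.non u)) → ℤ)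
    (hm0 : ∀ e : (thetaIndexOfInitial D).Caps j → (thetaIndexOfInitial D).Fibre (Val.non u),
      iota (ratChar u) ((presAtM D hlog u).kk e) (Fin.last _) ((presAtM D hlog u).labelIdele (t u) j (e (Fin.last _))) •
          (normalizedPacket (ratChar u) ((presAtM D hlog u).kk e) : Set ((presAtM D hlog u).X e)) ⊆
        (((ratChar u : ℕ) : ℚ_[ratChar u]) ^ m e) • (logPacket (ratChar u) ((presAtM D hlog u).kk e) : Set ((presAtM D hlog u).X e)))
    (hm1 : ∀ e : (thetaIndexOfInitial D).Caps j → (thetaIndexOfInitial D).Fibre (Val.non u),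
      ¬ iota (ratChar u) ((presAtM D hlog u).kk e) (Fin.last _) ((presAtM D hlog u).labelIdele (t u) j (e (Fin.last _))) •
          (normalizedPacket (ratChar u) ((presAtM D hlog u).kk e) : Set ((presAtM D hlog u).X e)) ⊆
        (((ratChar u : ℕ) : ℚ_[ratChar u]) ^ (m e + 1)) • (logPacket (ratChar u) ((presAtM D hlog u).kk e) : Set ((presAtM D hlog u).X e)))
    (cout : ∀ x : (thetaIndexOfInitial D).Fibre (Val.non u), kOfM D (ratChar u) u (natCast_ratChar_mem u) x)
    (houtΛ : ∀ x, cout x ∈ logUnits (kOfM D (ratChar u) u (natCast_ratChar_mem u) x))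
    (hdom : ∀ x, ∀ z ∈ logUnits (kOfM D (ratChar u) u (natCast_ratChar_mem u) x), ‖z‖ ≤ ‖cout x‖) :
    (settingPrVolSharpM D hlog t tq M archPk archSub Ψ act Mmod region n lat sig split qData htq0 Sq htq1).qRegion j (Val.non u) ⊆
      (settingPrVolSharpM D hlog t tq M archPk archSub Ψ act Mmod region n lat sig split qData htq0 Sq htq1).thetaSlotHull j (Val.non u) ↔
      ∀ e : (thetaIndexOfInitial D).Caps j → (thetaIndexOfInitial D).Fibre (Val.non u),
        (ratChar u : ℝ) ^ m e * ‖tq u (e (Fin.last _))‖ ≤ ∏ a, ‖cout (e a)‖ := by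
  classical
  letI : Fintype ((presAtM D hlog u).factorIdx j) := factorIdxM_fintype D hlog j (Val.non u)
  have key := qRegion_subset_thetaSlotHull_iff_of_content
    (P := (settingPrVolSharpM D hlog t tq M archPk archSub Ψ act Mmod region n lat sig split qData htq0 Sq htq1))
    (presAtM D hlog u) j
    (frame_settingPrVolSharpM_non D hlog t tq M archPk archSub Ψ act Mmod region n lat sig split qData htq0 Sq htq1 j u)
    ((presAtM D hlog u).qCentre (tq u) j) rfl m
    (sUnion_thetaSlotImages_settingPrVolSharpM_subset D hlog t tq M archPk archSub Ψ act Mmod region n lat sig split qData htq0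
      Sq htq1 j u m hm0)
    (fun e => exists_mem_thetaRegion3_settingPrVolSharpM_exact_content D hlog t tq M archPk archSub Ψ act Mmod region
      n lat sig split qData htq0 Sq htq1 j u m e (hm0 e) (hm1 e))
    (fun e g' hg' => exists_ind2Family_comparison_eq_congr (S := situationPrVolM D hlog M archPk archSub Ψ act Mmod region)
      (presAtM D hlog u) j (fun v g'' hg'' => exists_ism_presAtM_of_image_logUnits_eq D hlog u v g'' hg'') e g' hg')
    cout houtΛ hdom
  rw [key]
  have hp0 : (0 : ℝ) < ratChar u := by exact_mod_cast (Fact.out : (ratChar u).Prime).pos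
  -- `‖c_{q,(v⃗,J)}‖ = ‖t_{q,v̲_j}‖` and `‖p^m‖ = p^{-m}`
  constructor
  · intro h e
    obtain ⟨J⟩ := (inferInstance : Nonempty (DIdx (ratChar u) ((presAtM D hlog u).kk e)))
    have h' := h e J
    rw [(presAtM D hlog u).norm_qCentre (tq u) j e J, Padic.norm_p_zpow, zpow_neg, ← div_eq_inv_mul,
      le_div_iff₀ (zpow_pos hp0 _), mul_comm] at h'
    exact h'
  · intro h e J
    rw [(presAtM D hlog u).norm_qCentre (tq u) j e J, Padic.norm_p_zpow, zpow_neg, ← div_eq_inv_mul, le_div_iff₀ (zpow_pos hp0 _), mul_comm]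
    exact h e

/-- **The archimedean packets are automatic**: at `v_ℚ = ∞` the (Ind3)-region is the whole packet (trivial archimedean container, abc-iut-s2-p8), and the
region lies in the slot hull (abc-iut-C-cert-2 `thetaRegion3_subset_thetaSlotHull`). [cite: Mochizuki2012, IUTchIV Thm. 1.10 Step (vii) p. 30] -/
theorem qRegion_subset_thetaSlotHull_settingPrVolSharpM_arc (j : (thetaIndexOfInitial D).Label) (w : InfinitePlace ℚ) :
    (settingPrVolSharpM D hlog t tq M archPk archSub Ψ act Mmod region n lat sig split qData htq0 Sq htq1).qRegion j
        (Val.arc w) ⊆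
      (settingPrVolSharpM D hlog t tq M archPk archSub Ψ act Mmod region n lat sig split qData htq0 Sq htq1).thetaSlotHull j
        (Val.arc w) := by
  intro x _
  have h0 : x ∈ (settingPrVolSharpM D hlog t tq M archPk archSub Ψ act Mmod region n lat sig split qData htq0 Sq htq1).thetaRegion3 j (Val.arc w) := by
    rw [thetaRegion3_settingPrVolSharpM_eq D hlog M archPk archSub Ψ act Mmod region n lat sig split qData t tq htq0 Sq htq1 0,
      thetaRegion_settingPrVolSharpM_arc]
    exact Set.mem_univ _
  exact (settingPrVolSharpM D hlog t tq M archPk archSub Ψ act Mmod region n lat sig split qData htq0 Sq htq1).thetaRegion3_subset_thetaSlotHull j (Val.arc w) h0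

/-! ## §2. The content-free closed forms -/

/-- **THE PER-PACKET SLOT CRITERION, content-free**: for NON-ZERO Θ-ideles and `cout(v̲)` of largest norm in `log_p(𝒪^×_{K_{v̲}})`,
`qRegion (j,u) ⊆ slot hull (j,u)` ⟺ for every summand `v⃗` and every `m ∈ ℤ` with LAST-slot box `⊆ p^m·log_p(R_{v⃗}^×)`: `p^m·‖t_{q,v̲_j}‖ ≤ ∏_a ‖cout(v̲_a)‖`
(the last-slot box HAS an exact content — it contains the non-zero `ι_j(t)` and is `ψ`-bounded, abc-iut-c312-3 `exists_content`; the right side is monotone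
in the exponent). [cite: Mochizuki2012, IUTchIII Cor. 3.12 Step (x) p. 181, Step (xi-f) p. 184] [cite: WeilBNT1967, Ch. II §2, Th. 2] -/
theorem qRegion_subset_thetaSlotHull_settingPrVolSharpM_iff (ht0 : ∀ u i x, t u i x ≠ 0) (j : (thetaIndexOfInitial D).Label)
    (u : FinitePlace ℚ)
    (cout : ∀ x : (thetaIndexOfInitial D).Fibre (Val.non u), kOfM D (ratChar u) u (natCast_ratChar_mem u) x)
    (houtΛ : ∀ x, cout x ∈ logUnits (kOfM D (ratChar u) u (natCast_ratChar_mem u) x))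
    (hdom : ∀ x, ∀ z ∈ logUnits (kOfM D (ratChar u) u (natCast_ratChar_mem u) x), ‖z‖ ≤ ‖cout x‖) :
    (settingPrVolSharpM D hlog t tq M archPk archSub Ψ act Mmod region n lat sig split qData htq0 Sq htq1).qRegion j (Val.non u) ⊆
      (settingPrVolSharpM D hlog t tq M archPk archSub Ψ act Mmod region n lat sig split qData htq0 Sq htq1).thetaSlotHull j (Val.non u) ↔
      ∀ (e : (thetaIndexOfInitial D).Caps j → (thetaIndexOfInitial D).Fibre (Val.non u)) (m : ℤ),
        iota (ratChar u) ((presAtM D hlog u).kk e) (Fin.last _) ((presAtM D hlog u).labelIdele (t u) j (e (Fin.last _))) •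
            (normalizedPacket (ratChar u) ((presAtM D hlog u).kk e) : Set ((presAtM D hlog u).X e)) ⊆
          (((ratChar u : ℕ) : ℚ_[ratChar u]) ^ m) • (logPacket (ratChar u) ((presAtM D hlog u).kk e) : Set ((presAtM D hlog u).X e)) →
        (ratChar u : ℝ) ^ m * ‖tq u (e (Fin.last _))‖ ≤ ∏ a, ‖cout (e a)‖ := by
  classical
  -- the exact content family of the last-slot boxes
  have hne : ∀ e : (thetaIndexOfInitial D).Caps j → (thetaIndexOfInitial D).Fibre (Val.non u),
      ∃ x ∈ iota (ratChar u) ((presAtM D hlog u).kk e) (Fin.last _) ((presAtM D hlog u).labelIdele (t u) j (e (Fin.last _))) •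
          (normalizedPacket (ratChar u) ((presAtM D hlog u).kk e) : Set ((presAtM D hlog u).X e)), x ≠ 0 := by
    intro e
    refine ⟨iota (ratChar u) ((presAtM D hlog u).kk e) (Fin.last _) ((presAtM D hlog u).labelIdele (t u) j (e (Fin.last _))), ?_,
      (map_ne_zero (iota (ratChar u) ((presAtM D hlog u).kk e) (Fin.last _))).mpr
        ((presAtM D hlog u).labelIdele_ne_zero (t u) (ht0 u) j (e (Fin.last _)))⟩
    have h := Set.smul_mem_smul_set
      (a := iota (ratChar u) ((presAtM D hlog u).kk e) (Fin.last _) ((presAtM D hlog u).labelIdele (t u) j (e (Fin.last _))))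
      (Subring.one_mem (normalizedPacket (ratChar u) ((presAtM D hlog u).kk e)) : (1 : (presAtM D hlog u).X e) ∈
        (normalizedPacket (ratChar u) ((presAtM D hlog u).kk e) : Set ((presAtM D hlog u).X e)))
    rwa [smul_eq_mul, mul_one] at h
  have hex := fun e : (thetaIndexOfInitial D).Caps j → (thetaIndexOfInitial D).Fibre (Val.non u) =>
    exists_content (ratChar u) ((presAtM D hlog u).kk e) (isPsiBounded_smul_normalizedPacket (ratChar u) ((presAtM D hlog u).kk e) _) (hne e)
  choose m hm0 hm1 using hex
  rw [qRegion_subset_thetaSlotHull_settingPrVolSharpM_iff_of_content D hlog t tq M archPk archSub Ψ act Mmod region n lat sig split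
    qData htq0 Sq htq1 j u m hm0 hm1 cout houtΛ hdom]
  have hp1 : (1 : ℝ) ≤ ratChar u := by exact_mod_cast (Fact.out : (ratChar u).Prime).one_lt.le
  refine forall_congr' fun e => ⟨fun h m' hm' => ?_, fun h => h (m e) (hm0 e)⟩
  -- `m' ≤ m(v⃗)` by exactness of the content; the right side is monotone in the exponent
  have hle : m' ≤ m e := by
    by_contra hlt
    exact hm1 e (hm'.trans (zpow_smul_logPacket_anti (ratChar u) ((presAtM D hlog u).kk e) (by omega)))
  calc (ratChar u : ℝ) ^ m' * ‖tq u (e (Fin.last _))‖ ≤ (ratChar u : ℝ) ^ m e * ‖tq u (e (Fin.last _))‖ :=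
        mul_le_mul_of_nonneg_right (zpow_le_zpow_right₀ hp1 hle) (norm_nonneg _)
    _ ≤ _ := h

section Radii

/-! abc-iut-c312-5's BINDER CONVENTION per place `v̲` over `u` (VERBATIM abc-iut-w5-d166's): INNER radius `cin u v̲` (largest ball inside `log_p(𝒪^×_{K_{v̲}})`:
`hin0`, `hin`, maximality `hmax`); OUTER radius `cout u v̲ ∈ log_p(𝒪^×_{K_{v̲}})` of largest norm (`houtΛ`, `hdom`); NON-ZERO Θ-ideles (`ht0`). -/

variable (ht0 : ∀ u i x, t u i x ≠ 0)
  (cin cout : ∀ (u : FinitePlace ℚ) (x : (thetaIndexOfInitial D).Fibre (Val.non u)),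
    kOfM D (ratChar u) u (natCast_ratChar_mem u) x)
  (hin0 : ∀ u x, cin u x ≠ 0)
  (hin : ∀ u x (o : kOfM D (ratChar u) u (natCast_ratChar_mem u) x), ‖o‖ ≤ 1 →
    cin u x * o ∈ logUnits (kOfM D (ratChar u) u (natCast_ratChar_mem u) x))
  (hmax : ∀ u x, ∃ (ϖ : (kOfM D (ratChar u) u (natCast_ratChar_mem u) x)ˣ)
    (w : kOfM D (ratChar u) u (natCast_ratChar_mem u) x),
    IsUniformizer ϖ ∧ w ∉ logUnits (kOfM D (ratChar u) u (natCast_ratChar_mem u) x) ∧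
      ‖w‖ * ‖(ϖ : kOfM D (ratChar u) u (natCast_ratChar_mem u) x)‖ ≤ ‖cin u x‖)
  (houtΛ : ∀ u x, cout u x ∈ logUnits (kOfM D (ratChar u) u (natCast_ratChar_mem u) x))
  (hdom : ∀ u x, ∀ z ∈ logUnits (kOfM D (ratChar u) u (natCast_ratChar_mem u) x), ‖z‖ ≤ ‖cout u x‖)

include ht0 hin0 hin hmax houtΛ hdom

/-- **THE PER-PACKET SLOT CRITERION in closed form (inner and outer radii)** — the reading-(P) twin of abc-iut-w5-d166's
`qRegion_subset_thetaHull_settingPrVolSharpM_iff_radii`, with the LAST-slot box ALONE in place of the (Ind1)-slot union: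
`qRegion (j,u) ⊆ slot hull (j,u) ⟺ ∀ v⃗ ∀ m ∈ ℤ, (∀ J, p^m·‖t_{Θ,j,v̲_j}‖ ≤ p^{−(d_I − d_{L_J})}·∏_b ρ_in(v̲_b)) → p^m·‖t_{q,v̲_j}‖ ≤ ∏_b ρ_out(v̲_b)`
(abc-iut-c312-5 `iota_smul_normalizedPacket_subset_zpow_smul_logPacket_iff` at the last slot). [cite: Mochizuki2012, IUTchIV Prop. 1.1 p. 9,
Prop. 1.2 (i)(ii) p. 10; IUTchIII Cor. 3.12 Step (x) p. 181, Step (xi-f) p. 184] [cite: DupuyHilado2025, §3.7, §4.9, §4.12] -/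
theorem qRegion_subset_thetaSlotHull_settingPrVolSharpM_iff_radii (j : (thetaIndexOfInitial D).Label) (u : FinitePlace ℚ) :
    (settingPrVolSharpM D hlog t tq M archPk archSub Ψ act Mmod region n lat sig split qData htq0 Sq htq1).qRegion j (Val.non u) ⊆
      (settingPrVolSharpM D hlog t tq M archPk archSub Ψ act Mmod region n lat sig split qData htq0 Sq htq1).thetaSlotHull j (Val.non u) ↔
      ∀ (e : (thetaIndexOfInitial D).Caps j → (thetaIndexOfInitial D).Fibre (Val.non u)) (m : ℤ),
        (∀ J : DIdx (ratChar u) ((presAtM D hlog u).kk e),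
          (ratChar u : ℝ) ^ m * ‖(presAtM D hlog u).labelIdele (t u) j (e (Fin.last _))‖ ≤
            (ratChar u : ℝ) ^ (-(dSum (ratChar u) ((presAtM D hlog u).kk e) -
              differentOrd (ratChar u) (DFac (ratChar u) ((presAtM D hlog u).kk e) J))) * ∏ b, ‖cin u (e b)‖) →
        (ratChar u : ℝ) ^ m * ‖tq u (e (Fin.last _))‖ ≤ ∏ b, ‖cout u (e b)‖ := by
  rw [qRegion_subset_thetaSlotHull_settingPrVolSharpM_iff D hlog t tq M archPk archSub Ψ act Mmod region n lat sig split qData htq0 Sq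
    htq1 ht0 j u (cout u) (houtΛ u) (hdom u)]
  refine forall_congr' fun e => forall_congr' fun m => imp_congr ?_ Iff.rfl
  exact iota_smul_normalizedPacket_subset_zpow_smul_logPacket_iff (ratChar u) ((presAtM D hlog u).kk e)
    (c := fun b => cin u (e b)) (fun b => hin0 u (e b)) (fun b => hin u (e b)) (fun b => hmax u (e b)) (Fin.last _) _ m

/-! ## §3. The SLOT licence at the M-level setting of record, and at the datum's own ideles -/

/-- **THE SLOT LICENCE AT THE M LEVEL, decided** — abc-iut-C-cert-2's `Cor312.Setting.SlotLicence` of abc-iut-s2-p8's summand-route sharp setting («at every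
label `j = i+1 ∈ 𝔽_l^⋇` and every `v_ℚ` the q-pilot region lies in the (Ind1)-FREE slot hull») ⟺ the closed-form per-packet condition of §2 at every finite
rational place and every label `i+1` (archimedean packets automatic, §1): for every `u`, `i`, `v⃗ : S^±_{i+2} → V̲_u`, `m ∈ ℤ`:
(`∀ J, p_u^m·‖t_{Θ,i+1,v̲_{i+1}}‖ ≤ p_u^{−(d_I − d_{L_J})}·∏_b ρ_in(v̲_b)`) `→ p_u^m·‖t_{q,v̲_{i+1}}‖ ≤ ∏_b ρ_out(v̲_b)`. The reading-(P) twin of abc-iut-w5-d166's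
`licence_settingPrVolSharpM_iff_radii` (there: `∀ a J` over ALL slots). Sharp reading, OUR typed (Ind2)/(Ind3); nothing about the printed GLOBAL inequality.
[cite: Mochizuki2012, IUTchIII Cor. 3.12 p. 173–174, Step (x) p. 181, Step (xi-f) p. 184] [cite: DupuyHilado2025, §4.9, §4.11–4.12] -/
theorem slotLicence_settingPrVolSharpM_iff_radii :
    (settingPrVolSharpM D hlog t tq M archPk archSub Ψ act Mmod region n lat sig split qData htq0 Sq htq1).SlotLicence ↔
      ∀ (u : FinitePlace ℚ) (i : Fin (thetaIndexOfInitial D).lstar)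
        (e : (thetaIndexOfInitial D).Caps (Setting.labelSucc i) → (thetaIndexOfInitial D).Fibre (Val.non u)) (m : ℤ),
        (∀ J : DIdx (ratChar u) ((presAtM D hlog u).kk e),
          (ratChar u : ℝ) ^ m * ‖t u i (e (Fin.last _))‖ ≤
            (ratChar u : ℝ) ^ (-(dSum (ratChar u) ((presAtM D hlog u).kk e) -
              differentOrd (ratChar u) (DFac (ratChar u) ((presAtM D hlog u).kk e) J))) * ∏ b, ‖cin u (e b)‖) →
        (ratChar u : ℝ) ^ m * ‖tq u (e (Fin.last _))‖ ≤ ∏ b, ‖cout u (e b)‖ := by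
  rw [Cor312.Setting.slotLicence_iff]
  constructor
  · intro h u i e m hm
    refine (qRegion_subset_thetaSlotHull_settingPrVolSharpM_iff_radii D hlog t tq M archPk archSub Ψ act Mmod region n lat sig split
      qData htq0 Sq htq1 ht0 cin cout hin0 hin hmax houtΛ hdom (Setting.labelSucc i) u).mp (h i (Val.non u)) e m fun J => ?_
    rw [PadicPresentation.labelIdele_labelSucc]
    exact hm J
  · intro h i vQ
    rcases vQ with w | u
    · exact qRegion_subset_thetaSlotHull_settingPrVolSharpM_arc D hlog t tq M archPk archSub Ψ act Mmod region n lat sig split qData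
        htq0 Sq htq1 _ w
    · refine (qRegion_subset_thetaSlotHull_settingPrVolSharpM_iff_radii D hlog t tq M archPk archSub Ψ act Mmod region n lat sig
        split qData htq0 Sq htq1 ht0 cin cout hin0 hin hmax houtΛ hdom (Setting.labelSucc i) u).mpr fun e m hm =>
        h u i e m fun J => ?_
      have := hm J
      rwa [PadicPresentation.labelIdele_labelSucc] at this

end Radii

section OwnIdeles

variable (r : ThetaData.IdeleData D)
  (htq0' : ∀ (u : FinitePlace ℚ) (x : (thetaIndexOfInitial D).Fibre (Val.non u)),
    tqM D (ratChar u) u (natCast_ratChar_mem u) r x ≠ 0)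
  (Sq' : Finset (FinitePlace ℚ))
  (htq1' : ∀ (u : FinitePlace ℚ) (x : (thetaIndexOfInitial D).Fibre (Val.non u)), u ∉ Sq' →
    ‖tqM D (ratChar u) u (natCast_ratChar_mem u) r x‖ = 1)
  (cin cout : ∀ (u : FinitePlace ℚ) (x : (thetaIndexOfInitial D).Fibre (Val.non u)),
    kOfM D (ratChar u) u (natCast_ratChar_mem u) x)
  (hin0 : ∀ u x, cin u x ≠ 0)
  (hin : ∀ u x (o : kOfM D (ratChar u) u (natCast_ratChar_mem u) x), ‖o‖ ≤ 1 →
    cin u x * o ∈ logUnits (kOfM D (ratChar u) u (natCast_ratChar_mem u) x))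
  (hmax : ∀ u x, ∃ (ϖ : (kOfM D (ratChar u) u (natCast_ratChar_mem u) x)ˣ)
    (w : kOfM D (ratChar u) u (natCast_ratChar_mem u) x),
    IsUniformizer ϖ ∧ w ∉ logUnits (kOfM D (ratChar u) u (natCast_ratChar_mem u) x) ∧
      ‖w‖ * ‖(ϖ : kOfM D (ratChar u) u (natCast_ratChar_mem u) x)‖ ≤ ‖cin u x‖)
  (houtΛ : ∀ u x, cout u x ∈ logUnits (kOfM D (ratChar u) u (natCast_ratChar_mem u) x))
  (hdom : ∀ u x, ∀ z ∈ logUnits (kOfM D (ratChar u) u (natCast_ratChar_mem u) x), ‖z‖ ≤ ‖cout u x‖)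

include hin0 hin hmax houtΛ hdom in
/-- **THE SLOT LICENCE AT THE OWN-IDELES M SETTING, decided** (labels `j = i+1 ∈ 𝔽_l^⋇`; the setting of the M-line γ / joint certificates p469493 / p469550 /
p469640, whose binders' antecedent is its NEGATION): `SlotLicence` ⟺ for every `u`, `i`, `v⃗ : S^±_{i+2} → V̲_u`, `m ∈ ℤ`:
(`∀ J, p_u^m·‖t_{q,v̲_{i+1}}‖^{(i+1)²} ≤ p_u^{−(d_I − d_{L_J})}·∏_b ‖cin(v̲_b)‖`) `→ p_u^m·‖t_{q,v̲_{i+1}}‖ ≤ ∏_b ‖cout(v̲_b)‖` — ONE q-idele norm (that of the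
LAST slot `v̲_{i+1}`) and the radii per summand (`‖t_{Θ,i+1,v̲}‖ = ‖t_{q,v̲}‖^{(i+1)²}`, abc-iut-w5-d166 `norm_tThetaM_eq_norm_tqM_pow`, Dupuy–Hilado (3.4)).
The reading-(P) twin of abc-iut-w5-d166's `licence_settingPrVolSharpM_tOfIdeleData_iff_radii`. [cite: Mochizuki2012, IUTchIII Cor. 3.12 p. 173–174,
Step (x) p. 181, Step (xi-f) p. 184] [cite: DupuyHilado2025, §3.4, §4.11–4.12] -/
theorem slotLicence_settingPrVolSharpM_tOfIdeleData_iff_radii :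
    (settingPrVolSharpM D hlog (tOfIdeleData D r) (fun u x => tqM D (ratChar u) u (natCast_ratChar_mem u) r x) M archPk archSub Ψ
          act Mmod region n lat sig split qData htq0' Sq' htq1').SlotLicence ↔
      ∀ (u : FinitePlace ℚ) (i : Fin (thetaIndexOfInitial D).lstar)
        (e : (thetaIndexOfInitial D).Caps (Setting.labelSucc i) → (thetaIndexOfInitial D).Fibre (Val.non u)) (m : ℤ),
        (∀ J : DIdx (ratChar u) ((presAtM D hlog u).kk e),
          (ratChar u : ℝ) ^ m * ‖tqM D (ratChar u) u (natCast_ratChar_mem u) r (e (Fin.last _))‖ ^ (((i : ℕ) + 1) ^ 2) ≤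
            (ratChar u : ℝ) ^ (-(dSum (ratChar u) ((presAtM D hlog u).kk e) -
              differentOrd (ratChar u) (DFac (ratChar u) ((presAtM D hlog u).kk e) J))) * ∏ b, ‖cin u (e b)‖) →
        (ratChar u : ℝ) ^ m * ‖tqM D (ratChar u) u (natCast_ratChar_mem u) r (e (Fin.last _))‖ ≤ ∏ b, ‖cout u (e b)‖ := by
  rw [slotLicence_settingPrVolSharpM_iff_radii D hlog (tOfIdeleData D r)
    (fun u x => tqM D (ratChar u) u (natCast_ratChar_mem u) r x) M archPk archSub Ψ act Mmod region n lat sig split qData htq0' Sq' htq1'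
    (tOfIdeleData_ne_zero D r) cin cout hin0 hin hmax houtΛ hdom]
  refine forall_congr' fun u => forall_congr' fun i => forall_congr' fun e => forall_congr' fun m => imp_congr ?_ Iff.rfl
  refine forall_congr' fun J => ?_
  rw [show ‖tOfIdeleData D r u i (e (Fin.last _))‖ =
      ‖tqM D (ratChar u) u (natCast_ratChar_mem u) r (e (Fin.last _))‖ ^ (((i : ℕ) + 1) ^ 2) from
    norm_tThetaM_eq_norm_tqM_pow D r (ratChar u) u (natCast_ratChar_mem u) i (e (Fin.last _))]

end OwnIdeles

end Summit.ABC.IUTFork.Thm311.Real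

end
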